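import Summits.NavierStokesRegularity.NavierStokesRegularity.Theorems.TypeICertificateLadderRungReynoldsOneLambSlab
import Literature.Analysis.FluidPDE.CheskidovAssemblyTools
import HarnessLib

/-!
# Crux `Target` = `TypeICertificateLadder.NoTypeIBlowup` (stmt-NavierStokesRegularity-1217), line
# `depletion-ladder`: the LAMB–ENERGY SLACK in the enstrophy production (slice form)

`--supports stmt-NavierStokesRegularity-1217` (line `depletion-ladder`; bears on stub S1
`stub_depletionBelowHalf` — structure of near-extremisers of the depletion constant — and sharpens the
`q = 2` bookkeeping behind stub S2).

The multiplier form of the enstrophy balance (tree: `RungReynoldsOne.integral_sum_inner_fderiv_le_lamb`,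
Lemarié-Rieusset 2016 Thm. 11.2 (11.9), convective term in Lamb form) reads at one time, with
`W = ∂ₜu`, `v = u(t)`, `ω = curl v`: `∫ Σᵢ ⟪∂ᵢv, ∂ᵢW⟫ = −∫⟪Δv, W⟫ = −ν⁻¹ (‖W‖₂² + ∫⟪ω × v, W⟫)`
(the gradient pairings `⟪∇(|v|²/2), W⟫`, `⟪∇p, W⟫` vanish against the divergence-free `W`); the tree
closes it by completing the square POINTWISE, `−(|W|² + ⟪ω×v, W⟫) ≤ |ω × v|²/4`. That square is
complete only if `W` is antiparallel to the Lamb vector, which is ORTHOGONAL TO `v`; but the energy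
identity at the same slice, `∫⟪v, W⟫ = −ν‖∇v‖₂²`, forces `W` to carry a component ALONG `v` of
`L²`-size `≥ ν‖∇v‖₂²/‖v‖₂`, invisible to the Lamb vector: `∫⟪ω×v, W⟫ = ∫⟪ω×v, W + λv⟫` for every
real `λ`, and `‖W + λv‖₂² = ‖W‖₂² − ν²‖∇v‖₂⁴/‖v‖₂²` at `λ = ν‖∇v‖₂²/‖v‖₂²`. Completing the square
in this smaller quantity gives the slice inequality WITH A LOGISTIC CORRECTION
(`integral_sum_inner_fderiv_le_lamb_energy`):

  `∫ Σᵢ ⟪∂ᵢv, ∂ᵢW⟫ ≤ (4ν)⁻¹ ∫ |v|²|curl v|² − ν (∫|∇v|²_F)² / ∫|v|²`,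

i.e. `d/dt ‖∇u‖₂² ≤ (‖u‖²_∞/(2ν)) ‖∇u‖₂² − (2ν/‖u‖₂²) ‖∇u‖₂⁴` in place of the classical Grönwall
slice. For S1: the depletion ratio `R` (`κ̂` ≈ 0.14 numerically) and the spectral concentration
`Q = ‖∇v‖₂⁴/(‖v‖₂²‖Δv‖₂²) ∈ (0,1]` obey `R² + Q ≤ 1` (companion file) — near-extremisers are broadband.
WHAT THIS IS NOT: not a depletion constant `κ < 1` (S1 open); under a Type-I rate the logistic term
is lower order at the blow-up time (enstrophy cap `O((T−t)⁻¹)`, exponent above `1/2`). [folklore]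

References: Lemarié-Rieusset, *The Navier–Stokes Problem in the 21st Century* (2016), Thm. 11.2;
Doering–Gibbon, *Applied Analysis of the Navier–Stokes Equations* (1995), ch. 5–6; Majda–Bertozzi,
*Vorticity and Incompressible Flow* (2002), §2.1 (Lamb form).
-/

noncomputable section

open Set Filter Topology MeasureTheory
open scoped RealInnerProductSpace ENNReal NNReal Laplacian ContDiff
open Literature.Analysis.FluidPDE

namespace Summit.NavierStokesRegularity.NavierStokesRegularity.Theorems.DepletionLadder

-- the problem directory repeats the summit name (`NavierStokesRegularity/NavierStokesRegularity`)
set_option linter.dupNamespace false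

open Summit.NavierStokesRegularity.NavierStokesRegularity.Theorems.RungReynoldsOne

/-- The Lamb vector is orthogonal to the velocity: `⟪(curl v) × v, v⟫ = 0` pointwise. [folklore] -/
theorem inner_cross_curl_self (a b : EuclideanSpace ℝ (Fin 3)) : ⟪cross a b, b⟫ = 0 := by
  simp [cross, cross_apply, PiLp.inner_apply, Fin.sum_univ_three]
  ring

/-- **Blind direction of the Lamb pairing.** If `L ⊥ v` pointwise, its `L²` pairing with `F` sees
`F` only modulo multiples of `v`: `|∫⟪L, F⟫| ≤ ‖L‖₂ ‖F + λ v‖₂` for every real `λ`. [folklore] -/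
theorem abs_integral_inner_le_of_inner_eq_zero
    {L F v : EuclideanSpace ℝ (Fin 3) → EuclideanSpace ℝ (Fin 3)}
    (hperp : ∀ x, ⟪L x, v x⟫ = 0) (hL : MemLp L 2 volume) (hF : MemLp F 2 volume)
    (hv : MemLp v 2 volume) (lam : ℝ) :
    |∫ x, ⟪L x, F x⟫| ≤
      Real.sqrt (∫ x, ‖L x‖ ^ 2) * Real.sqrt (∫ x, ‖F x + lam • v x‖ ^ 2) := by
  have hFv : MemLp (fun x => F x + lam • v x) 2 volume := hF.add (hv.const_smul lam)
  have heq : ∫ x, ⟪L x, F x⟫ = ∫ x, ⟪L x, F x + lam • v x⟫ :=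
    integral_congr_ae (Eventually.of_forall fun x => by
      simp only [inner_add_right, real_inner_smul_right, hperp x, mul_zero, add_zero])
  rw [heq]
  exact abs_integral_inner_le_sqrt_mul_sqrt hL hFv

/-- **The enstrophy production slice bound with the Lamb–energy slack (multiplier form).**
Setting of `RungReynoldsOne.integral_sum_inner_fderiv_le_lamb` (`v ∈ C²`, `W, q ∈ C¹`,
`W + (v·∇)v = νΔv − ∇q`, `div W = 0`, `|v| ≤ M`, `v, ∇v, D²v, W, ∇W, q, ∇q ∈ L²`) plus `div v = 0`:
`∫ Σᵢ ⟪∂ᵢv, ∂ᵢW⟫ ≤ (4ν)⁻¹ ∫ |v|²|curl v|² − ν (∫|∇v|²_F)² / ∫|v|²`. Proof: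
`∫ Σᵢ⟪∂ᵢv, ∂ᵢW⟫ = −ν⁻¹(‖W‖₂² + ∫⟪curl v × v, W⟫)`; energy slice `∫⟪v, W⟫ = −ν∫|∇v|²_F`; the Lamb
vector is orthogonal to `v`, so `|∫⟪curl v × v, W⟫| ≤ ‖curl v × v‖₂ ‖W + λv‖₂`, and at
`λ = ν∫|∇v|²_F/∫|v|²`, `‖W + λv‖₂² = ‖W‖₂² − ν²(∫|∇v|²_F)²/∫|v|²`; then `ab ≤ a²/4 + b²`.
(If `∫|v|² = 0` the correction is `0` by convention and the bound is the tree's.) [folklore] -/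
theorem integral_sum_inner_fderiv_le_lamb_energy {ν : ℝ} (hν : 0 < ν)
    {v W : EuclideanSpace ℝ (Fin 3) → EuclideanSpace ℝ (Fin 3)} {q : EuclideanSpace ℝ (Fin 3) → ℝ}
    (hv : ContDiff ℝ 2 v) (hW : ContDiff ℝ 1 W) (hq : ContDiff ℝ 1 q)
    (hmom : ∀ x, W x + convect v v x = ν • (Δ v) x - gradient q x)
    (hdivv : VectorCalculus.IsDivFree v) (hdivW : VectorCalculus.IsDivFree W) {M : ℝ}
    (hM : ∀ x, ‖v x‖ ≤ M)
    (hv0 : ∫⁻ x, ‖v x‖ₑ ^ 2 < ⊤)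
    (hv1 : ∫⁻ x, ENNReal.ofReal (frobeniusNormSq (fderiv ℝ v x)) < ⊤)
    (hv2 : ∫⁻ x, ‖iteratedFDeriv ℝ 2 v x‖ₑ ^ 2 < ⊤)
    (hW0 : ∫⁻ x, ‖W x‖ₑ ^ 2 < ⊤) (hW1 : ∫⁻ x, ‖iteratedFDeriv ℝ 1 W x‖ₑ ^ 2 < ⊤)
    (hq0 : ∫⁻ x, ‖q x‖ₑ ^ 2 < ⊤) (hq1 : ∫⁻ x, ‖iteratedFDeriv ℝ 1 q x‖ₑ ^ 2 < ⊤) :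
    ∫ x, ∑ i, ⟪fderiv ℝ v x (EuclideanSpace.basisFun (Fin 3) ℝ i),
        fderiv ℝ W x (EuclideanSpace.basisFun (Fin 3) ℝ i)⟫ ≤
      (4 * ν)⁻¹ * (∫ x, ‖v x‖ ^ 2 * ‖curl v x‖ ^ 2) -
        ν * (∫ x, frobeniusNormSq (fderiv ℝ v x)) ^ 2 / ∫ x, ‖v x‖ ^ 2 := by
  set e := EuclideanSpace.basisFun (Fin 3) ℝ with he
  have he1 : ∀ i, ‖e i‖ = 1 := fun i => by simp [he]
  have hM0 : 0 ≤ M := (norm_nonneg _).trans (hM 0)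
  have hdv : Differentiable ℝ v := hv.differentiable two_ne_zero
  have hv' : ContDiff ℝ 1 v := hv.of_le one_le_two
  -- the Bernoulli head `B = |v|²/2`, with `DB(x) = ⟪v(x), Dv(x)·⟫`
  set B : EuclideanSpace ℝ (Fin 3) → ℝ := fun y => ‖v y‖ ^ 2 / 2 with hB
  have hBc : ContDiff ℝ 1 B := ((contDiff_norm_sq ℝ).comp hv').div_const 2
  have hDB : ∀ x, fderiv ℝ B x = (innerSL ℝ (v x)).comp (fderiv ℝ v x) := fun x =>
    (hasFDerivAt_half_norm_sq (hdv x)).fderiv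
  -- continuity of all the fields involved
  have cv : Continuous v := hv.continuous
  have cDv : Continuous (fderiv ℝ v) := hv.continuous_fderiv two_ne_zero
  have cdiv : ∀ i, Continuous fun x => fderiv ℝ v x (e i) := fun i => cDv.clm_apply continuous_const
  have cddv : ∀ i, Continuous fun x => fderiv ℝ (fun y => fderiv ℝ v y (e i)) x (e i) := fun i =>
    ((((hv.fderiv_right (m := 1) le_rfl).clm_apply contDiff_const).continuous_fderiv
      one_ne_zero).clm_apply continuous_const)
  have cW : Continuous W := hW.continuous
  have cDW : Continuous (fderiv ℝ W) := hW.continuous_fderiv one_ne_zero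
  have cdiW : ∀ i, Continuous fun x => fderiv ℝ W x (e i) := fun i => cDW.clm_apply continuous_const
  have cgrad : ∀ {r : EuclideanSpace ℝ (Fin 3) → ℝ}, ContDiff ℝ 1 r → Continuous (gradient r) :=
    fun hr => (InnerProductSpace.toDual ℝ (EuclideanSpace ℝ (Fin 3))).symm.continuous.comp
      (hr.continuous_fderiv one_ne_zero)
  have cgq : Continuous (gradient q) := cgrad hq
  have cgB : Continuous (gradient B) := cgrad hBc
  have ccurl : Continuous (curl v) := continuous_curl hv'
  have ccross : Continuous fun x => cross (curl v x) (v x) :=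
    (crossCLM.continuous₂).comp (ccurl.prodMk cv) |>.congr (fun x => by simp [crossCLM_apply])
  have cLap : Continuous (Δ v) := by
    have : (Δ v) = fun x => ∑ i, fderiv ℝ (fun y => fderiv ℝ v y (e i)) x (e i) := by
      funext x; exact laplacian_eq_sum_fderiv_fderiv e hv x
    rw [this]
    exact continuous_finsetSum _ fun i _ => cddv i
  -- finite `L²` norms of the derived fields
  have l2Dv : ∫⁻ x, ‖fderiv ℝ v x‖ₑ ^ 2 < ⊤ := lintegral_enorm_sq_fderiv_lt_top hv1
  have l2div : ∀ i, ∫⁻ x, ‖fderiv ℝ v x (e i)‖ₑ ^ 2 < ⊤ := fun i =>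
    lintegral_enorm_sq_lt_top_of_norm_le (fun x => by
      simpa [he1] using (fderiv ℝ v x).le_opNorm (e i)) l2Dv
  have l2ddv : ∀ i, ∫⁻ x, ‖fderiv ℝ (fun y => fderiv ℝ v y (e i)) x (e i)‖ₑ ^ 2 < ⊤ := fun i =>
    lintegral_enorm_sq_lt_top_of_norm_le (fun x => norm_fderiv_fderiv_apply_basisFun_le hv x i) hv2
  have l2diW : ∀ i, ∫⁻ x, ‖fderiv ℝ W x (e i)‖ₑ ^ 2 < ⊤ := fun i =>
    lintegral_enorm_sq_lt_top_of_norm_le (fun x => norm_fderiv_apply_basisFun_le W x i) hW1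
  have l2diq : ∀ i, ∫⁻ x, ‖fderiv ℝ q x (e i)‖ₑ ^ 2 < ⊤ := fun i =>
    lintegral_enorm_sq_lt_top_of_norm_le (fun x => norm_fderiv_apply_basisFun_le q x i) hq1
  have l2gq : ∫⁻ x, ‖gradient q x‖ₑ ^ 2 < ⊤ := by
    refine lintegral_enorm_sq_lt_top_of_norm_le (fun x => ?_) hq1
    rw [gradient, LinearIsometryEquiv.norm_map, ← norm_iteratedFDeriv_fderiv,
      norm_iteratedFDeriv_zero]
  have l2MDv : ∫⁻ x, ‖M * ‖fderiv ℝ v x‖‖ₑ ^ 2 < ⊤ :=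
    lintegral_enorm_sq_const_mul_norm_lt_top M l2Dv
  have hDBle : ∀ x, ‖fderiv ℝ B x‖ ≤ ‖M * ‖fderiv ℝ v x‖‖ := fun x => by
    rw [hDB x]
    refine ((ContinuousLinearMap.opNorm_comp_le _ _).trans ?_).trans (Real.le_norm_self _)
    rw [innerSL_apply_norm]
    exact mul_le_mul_of_nonneg_right (hM x) (norm_nonneg _)
  have l2diB : ∀ i, ∫⁻ x, ‖fderiv ℝ B x (e i)‖ₑ ^ 2 < ⊤ := fun i =>
    lintegral_enorm_sq_lt_top_of_norm_le (fun x =>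
      le_trans (by simpa [he1] using (fderiv ℝ B x).le_opNorm (e i)) (hDBle x)) l2MDv
  have l2gB : ∫⁻ x, ‖gradient B x‖ₑ ^ 2 < ⊤ :=
    lintegral_enorm_sq_lt_top_of_norm_le (fun x => by
      rw [gradient, LinearIsometryEquiv.norm_map]; exact hDBle x) l2MDv
  have l2B : ∫⁻ x, ‖B x‖ₑ ^ 2 < ⊤ := by
    refine lintegral_enorm_sq_lt_top_of_norm_le (b := fun x => M / 2 * ‖v x‖) (fun x => ?_)
      (lintegral_enorm_sq_const_mul_norm_lt_top _ hv0)
    refine le_trans ?_ (Real.le_norm_self _)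
    simp only [hB]
    rw [Real.norm_of_nonneg (by positivity)]
    nlinarith [hM x, norm_nonneg (v x)]
  have l2ω : ∫⁻ x, ‖curl v x‖ₑ ^ 2 < ⊤ :=
    lintegral_enorm_sq_lt_top_of_norm_le (b := fun x => ‖curlCLM‖ * ‖fderiv ℝ v x‖)
      (fun x => (norm_curl_le v x).trans (Real.le_norm_self _))
      (lintegral_enorm_sq_const_mul_norm_lt_top _ l2Dv)
  have l2curl : ∫⁻ x, ‖M * ‖curl v x‖‖ₑ ^ 2 < ⊤ := lintegral_enorm_sq_const_mul_norm_lt_top M l2ω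
  have l2cross : ∫⁻ x, ‖cross (curl v x) (v x)‖ₑ ^ 2 < ⊤ := by
    refine lintegral_enorm_sq_lt_top_of_norm_le (b := fun x => M * ‖curl v x‖) (fun x => ?_) l2curl
    refine le_trans ?_ (Real.le_norm_self _)
    have hcr : ‖cross (curl v x) (v x)‖ ≤ ‖v x‖ * ‖curl v x‖ := by
      rw [norm_cross, mul_comm ‖v x‖]
      nlinarith [Real.sin_le_one (InnerProductGeometry.angle (curl v x) (v x)),
        mul_nonneg (norm_nonneg (curl v x)) (norm_nonneg (v x))]
    exact hcr.trans (mul_le_mul_of_nonneg_right (hM x) (norm_nonneg _))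
  have l2Lap : ∫⁻ x, ‖(Δ v) x‖ₑ ^ 2 < ⊤ := by
    refine lintegral_enorm_sq_lt_top_of_norm_le (b := fun x => (3 : ℝ) * ‖iteratedFDeriv ℝ 2 v x‖)
      (fun x => ?_) (lintegral_enorm_sq_const_mul_norm_lt_top _ hv2)
    refine le_trans ?_ (Real.le_norm_self _)
    rw [laplacian_eq_sum_fderiv_fderiv e hv x]
    calc ‖∑ i, fderiv ℝ (fun y => fderiv ℝ v y (e i)) x (e i)‖
        ≤ ∑ i, ‖fderiv ℝ (fun y => fderiv ℝ v y (e i)) x (e i)‖ := norm_sum_le _ _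
      _ ≤ ∑ _i : Fin 3, ‖iteratedFDeriv ℝ 2 v x‖ :=
          Finset.sum_le_sum fun i _ => norm_fderiv_fderiv_apply_basisFun_le hv x i
      _ = 3 * ‖iteratedFDeriv ℝ 2 v x‖ := by simp
  -- integrability of the products (pairings with `W`, as in the tree)
  have i1 : ∀ i, Integrable (fun x => ⟪fderiv ℝ (fun y => fderiv ℝ v y (e i)) x (e i), W x⟫)
      volume := fun i =>
    integrable_of_norm_le_mul_of_lintegral_sq ((cddv i).inner cW).aestronglyMeasurable (cddv i) cW
      (l2ddv i) hW0 fun x => norm_inner_le_norm _ _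
  have i2 : ∀ i, Integrable (fun x => ⟪fderiv ℝ v x (e i), fderiv ℝ W x (e i)⟫) volume := fun i =>
    integrable_of_norm_le_mul_of_lintegral_sq ((cdiv i).inner (cdiW i)).aestronglyMeasurable
      (cdiv i) (cdiW i) (l2div i) (l2diW i) fun x => norm_inner_le_norm _ _
  have i3 : ∀ i, Integrable (fun x => ⟪fderiv ℝ v x (e i), W x⟫) volume := fun i =>
    integrable_of_norm_le_mul_of_lintegral_sq ((cdiv i).inner cW).aestronglyMeasurable (cdiv i) cW
      (l2div i) hW0 fun x => norm_inner_le_norm _ _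
  have j1 : ∀ i, Integrable (fun x => ⟪fderiv ℝ (fun y => fderiv ℝ v y (e i)) x (e i), v x⟫)
      volume := fun i =>
    integrable_of_norm_le_mul_of_lintegral_sq ((cddv i).inner cv).aestronglyMeasurable (cddv i) cv
      (l2ddv i) hv0 fun x => norm_inner_le_norm _ _
  have j2 : ∀ i, Integrable (fun x => ⟪fderiv ℝ v x (e i), fderiv ℝ v x (e i)⟫) volume := fun i =>
    integrable_of_norm_le_mul_of_lintegral_sq ((cdiv i).inner (cdiv i)).aestronglyMeasurable
      (cdiv i) (cdiv i) (l2div i) (l2div i) fun x => norm_inner_le_norm _ _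
  have j3 : ∀ i, Integrable (fun x => ⟪fderiv ℝ v x (e i), v x⟫) volume := fun i =>
    integrable_of_norm_le_mul_of_lintegral_sq ((cdiv i).inner cv).aestronglyMeasurable (cdiv i) cv
      (l2div i) hv0 fun x => norm_inner_le_norm _ _
  have iLapv : Integrable (fun x => ⟪v x, (Δ v) x⟫) volume :=
    integrable_of_norm_le_mul_of_lintegral_sq (cv.inner cLap).aestronglyMeasurable cv cLap
      hv0 l2Lap fun x => norm_inner_le_norm _ _
  have igW : Integrable (fun x => ⟪gradient q x, W x⟫) volume :=
    integrable_of_norm_le_mul_of_lintegral_sq (cgq.inner cW).aestronglyMeasurable cgq cW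
      l2gq hW0 fun x => norm_inner_le_norm _ _
  have igB : Integrable (fun x => ⟪gradient B x, W x⟫) volume :=
    integrable_of_norm_le_mul_of_lintegral_sq (cgB.inner cW).aestronglyMeasurable cgB cW
      l2gB hW0 fun x => norm_inner_le_norm _ _
  have igqv : Integrable (fun x => ⟪gradient q x, v x⟫) volume :=
    integrable_of_norm_le_mul_of_lintegral_sq (cgq.inner cv).aestronglyMeasurable cgq cv
      l2gq hv0 fun x => norm_inner_le_norm _ _
  have igBv : Integrable (fun x => ⟪gradient B x, v x⟫) volume :=
    integrable_of_norm_le_mul_of_lintegral_sq (cgB.inner cv).aestronglyMeasurable cgB cv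
      l2gB hv0 fun x => norm_inner_le_norm _ _
  have iWW : Integrable (fun x => ⟪W x, W x⟫) volume :=
    integrable_of_norm_le_mul_of_lintegral_sq (cW.inner cW).aestronglyMeasurable cW cW
      hW0 hW0 fun x => norm_inner_le_norm _ _
  have icW : Integrable (fun x => ⟪cross (curl v x) (v x), W x⟫) volume :=
    integrable_of_norm_le_mul_of_lintegral_sq (ccross.inner cW).aestronglyMeasurable ccross cW
      l2cross hW0 fun x => norm_inner_le_norm _ _
  have ivW : Integrable (fun x => ⟪v x, W x⟫) volume :=
    integrable_of_norm_le_mul_of_lintegral_sq (cv.inner cW).aestronglyMeasurable cv cW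
      hv0 hW0 fun x => norm_inner_le_norm _ _
  have ivo : Integrable (fun x => ‖v x‖ ^ 2 * ‖curl v x‖ ^ 2) volume := by
    refine integrable_of_norm_le_mul_of_lintegral_sq (a := fun x => M * ‖curl v x‖)
      (b := fun x => M * ‖curl v x‖) ((cv.norm.pow 2).mul (ccurl.norm.pow 2)).aestronglyMeasurable
      (continuous_const.mul ccurl.norm) (continuous_const.mul ccurl.norm) l2curl l2curl fun x => ?_
    rw [Real.norm_of_nonneg (by positivity), Real.norm_of_nonneg (mul_nonneg hM0 (norm_nonneg _))]
    calc ‖v x‖ ^ 2 * ‖curl v x‖ ^ 2 ≤ M ^ 2 * ‖curl v x‖ ^ 2 := by gcongr; exact hM x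
      _ = M * ‖curl v x‖ * (M * ‖curl v x‖) := by ring
  have mL : MemLp (fun x => cross (curl v x) (v x)) 2 volume :=
    (memLp_two_iff_integrable_sq_norm ccross.aestronglyMeasurable).2
      (integrable_sq_norm_of_lintegral_lt_top ccross l2cross)
  have mW : MemLp W 2 volume :=
    (memLp_two_iff_integrable_sq_norm cW.aestronglyMeasurable).2
      (integrable_sq_norm_of_lintegral_lt_top cW hW0)
  have mv : MemLp v 2 volume :=
    (memLp_two_iff_integrable_sq_norm cv.aestronglyMeasurable).2
      (integrable_sq_norm_of_lintegral_lt_top cv hv0)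
  have isqv : Integrable (fun x => ‖v x‖ ^ 2) volume := integrable_sq_norm_of_lintegral_lt_top cv hv0
  have isqW : Integrable (fun x => ‖W x‖ ^ 2) volume := integrable_sq_norm_of_lintegral_lt_top cW hW0
  have isqc : Integrable (fun x => ‖cross (curl v x) (v x)‖ ^ 2) volume :=
    integrable_sq_norm_of_lintegral_lt_top ccross l2cross
  -- the gradient pairings vanish (against `W` and against `v`)
  have hin : ∀ i (y : EuclideanSpace ℝ (Fin 3)), ‖⟪e i, y⟫‖ ≤ ‖y‖ := fun i y =>
    (norm_inner_le_norm (𝕜 := ℝ) (e i) y).trans (by rw [he1, one_mul])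
  have hpair : ∀ {r : EuclideanSpace ℝ (Fin 3) → ℝ} {Y : EuclideanSpace ℝ (Fin 3) → EuclideanSpace ℝ (Fin 3)},
      ContDiff ℝ 1 r → (∫⁻ x, ‖r x‖ₑ ^ 2 < ⊤) → (∀ i, ∫⁻ x, ‖fderiv ℝ r x (e i)‖ₑ ^ 2 < ⊤) →
      ContDiff ℝ 1 Y → VectorCalculus.IsDivFree Y → (∫⁻ x, ‖Y x‖ₑ ^ 2 < ⊤) →
      (∀ i, ∫⁻ x, ‖fderiv ℝ Y x (e i)‖ₑ ^ 2 < ⊤) → ∫ x, ⟪gradient r x, Y x⟫ = 0 := by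
    intro r Y hr l2r l2dir hY hdivY hY0 l2diY
    have cr : Continuous r := hr.continuous
    have cY : Continuous Y := hY.continuous
    have cdiY : ∀ i, Continuous fun x => fderiv ℝ Y x (e i) := fun i =>
      (hY.continuous_fderiv one_ne_zero).clm_apply continuous_const
    have cdir : ∀ i, Continuous fun x => fderiv ℝ r x (e i) := fun i =>
      (hr.continuous_fderiv one_ne_zero).clm_apply continuous_const
    refine integral_inner_gradient_eq_zero_of_isDivFree_R3 hr hY hdivY (fun i => ?_) (fun i => ?_)
      (fun i => ?_)
    · exact integrable_of_norm_le_mul_of_lintegral_sq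
        ((continuous_const.inner cY).mul (cdir i)).aestronglyMeasurable cY (cdir i) hY0 (l2dir i)
        fun x => by rw [norm_mul]; exact mul_le_mul_of_nonneg_right (hin i _) (norm_nonneg _)
    · exact integrable_of_norm_le_mul_of_lintegral_sq
        ((continuous_const.inner (cdiY i)).mul cr).aestronglyMeasurable (cdiY i) cr (l2diY i) l2r
        fun x => by rw [norm_mul]; exact mul_le_mul_of_nonneg_right (hin i _) (norm_nonneg _)
    · exact integrable_of_norm_le_mul_of_lintegral_sq
        ((continuous_const.inner cY).mul cr).aestronglyMeasurable cY cr hY0 l2r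
        fun x => by rw [norm_mul]; exact mul_le_mul_of_nonneg_right (hin i _) (norm_nonneg _)
  have hpress : ∫ x, ⟪gradient q x, W x⟫ = 0 := hpair hq hq0 l2diq hW hdivW hW0 l2diW
  have hpressB : ∫ x, ⟪gradient B x, W x⟫ = 0 := hpair hBc l2B l2diB hW hdivW hW0 l2diW
  have hpressv : ∫ x, ⟪gradient q x, v x⟫ = 0 := hpair hq hq0 l2diq hv' hdivv hv0 l2div
  have hpressBv : ∫ x, ⟪gradient B x, v x⟫ = 0 := hpair hBc l2B l2diB hv' hdivv hv0 l2div
  set Z' : ℝ := ∫ x, frobeniusNormSq (fderiv ℝ v x) with hZ'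
  set E : ℝ := ∫ x, ‖v x‖ ^ 2 with hE
  set w2 : ℝ := ∫ x, ‖W x‖ ^ 2 with hw2
  set pc : ℝ := ∫ x, ⟪cross (curl v x) (v x), W x⟫ with hpc
  set a2 : ℝ := ∫ x, ‖cross (curl v x) (v x)‖ ^ 2 with ha2
  set P2 : ℝ := ∫ x, ‖v x‖ ^ 2 * ‖curl v x‖ ^ 2 with hP2
  have hE0 : 0 ≤ E := integral_nonneg fun x => sq_nonneg _
  have ha20 : 0 ≤ a2 := integral_nonneg fun x => sq_nonneg _
  -- `a2 ≤ P2` (pointwise `|curl v × v| ≤ |v||curl v|`)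
  have ha2P2 : a2 ≤ P2 := by
    refine integral_mono isqc ivo fun x => ?_
    have hcr : ‖cross (curl v x) (v x)‖ ≤ ‖v x‖ * ‖curl v x‖ := by
      rw [norm_cross, mul_comm ‖v x‖]
      nlinarith [Real.sin_le_one (InnerProductGeometry.angle (curl v x) (v x)),
        mul_nonneg (norm_nonneg (curl v x)) (norm_nonneg (v x))]
    have h0 : 0 ≤ ‖cross (curl v x) (v x)‖ := norm_nonneg _
    calc ‖cross (curl v x) (v x)‖ ^ 2 ≤ (‖v x‖ * ‖curl v x‖) ^ 2 := pow_le_pow_left₀ h0 hcr 2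
      _ = ‖v x‖ ^ 2 * ‖curl v x‖ ^ 2 := by ring
  -- `∫ Σᵢ ⟪∂ᵢv, ∂ᵢv⟫ = Z'` and `= −∫⟪Δv, v⟫`
  have hLapv := integral_sum_inner_fderiv_fderiv_eq_neg_integral_inner_laplacian hv hv' j1 j2 j3
  have hsumZ : ∫ x, ∑ i, ⟪fderiv ℝ v x (e i), fderiv ℝ v x (e i)⟫ = Z' := by
    refine integral_congr_ae (Eventually.of_forall fun x => ?_)
    dsimp only
    rw [frobeniusNormSq_eq_sum e]
    exact Finset.sum_congr rfl fun i _ => real_inner_self_eq_norm_sq _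
  have hvLap : ∫ x, ⟪v x, (Δ v) x⟫ = -Z' := by
    have h1 : ∫ x, ⟪v x, (Δ v) x⟫ = ∫ x, ⟪(Δ v) x, v x⟫ :=
      integral_congr_ae (Eventually.of_forall fun x => real_inner_comm _ _)
    rw [h1]
    linarith [hLapv, hsumZ]
  -- THE ENERGY SLICE: `∫⟪v, W⟫ = −ν Z'`
  have hvW_pt : ∀ x, ⟪v x, W x⟫ =
      ν * ⟪v x, (Δ v) x⟫ - ⟪gradient B x, v x⟫ - ⟪gradient q x, v x⟫ := by
    intro x
    have hWx : W x = ν • (Δ v) x - convect v v x - gradient q x := by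
      rw [eq_sub_of_add_eq (hmom x)]
      abel
    have hL : convect v v x = cross (curl v x) (v x) + gradient B x :=
      convect_self_eq_cross_curl_add_gradient (hdv x)
    have h0 : ⟪v x, cross (curl v x) (v x)⟫ = 0 := by
      rw [real_inner_comm]; exact inner_cross_curl_self _ _
    rw [hWx, hL, inner_sub_right, inner_sub_right, real_inner_smul_right, inner_add_right, h0,
      zero_add, real_inner_comm (gradient B x) (v x), real_inner_comm (gradient q x) (v x)]
  have hEW : ∫ x, ⟪v x, W x⟫ = -ν * Z' := by
    have iA1 : Integrable (fun x => ν * ⟪v x, (Δ v) x⟫ - ⟪gradient B x, v x⟫) volume :=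
      (iLapv.const_mul ν).sub igBv
    have iA0 : Integrable (fun x => ν * ⟪v x, (Δ v) x⟫) volume := iLapv.const_mul ν
    rw [integral_congr_ae (Eventually.of_forall hvW_pt), integral_sub iA1 igqv,
      integral_sub iA0 igBv, integral_const_mul, hvLap, hpressBv, hpressv]
    ring
  -- THE MAIN IDENTITY: `∫ Σᵢ⟪∂ᵢv, ∂ᵢW⟫ = −ν⁻¹ (w2 + pc)`
  have hLap := integral_sum_inner_fderiv_fderiv_eq_neg_integral_inner_laplacian hv hW i1 i2 i3
  have hpt : ∀ x, ⟪(Δ v) x, W x⟫ = ν⁻¹ * (⟪W x, W x⟫ + ⟪cross (curl v x) (v x), W x⟫ +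
      ⟪gradient B x, W x⟫ + ⟪gradient q x, W x⟫) := by
    intro x
    have hΔ : (Δ v) x = ν⁻¹ • (W x + convect v v x + gradient q x) := by
      have h := hmom x
      rw [eq_sub_iff_add_eq] at h
      rw [h, smul_smul, inv_mul_cancel₀ hν.ne', one_smul]
    have hL : convect v v x = cross (curl v x) (v x) + gradient B x :=
      convect_self_eq_cross_curl_add_gradient (hdv x)
    rw [hΔ, hL, real_inner_smul_left, inner_add_left, inner_add_left, inner_add_left]
    ring
  have hWW : ∫ x, ⟪W x, W x⟫ = w2 :=
    integral_congr_ae (Eventually.of_forall fun x => real_inner_self_eq_norm_sq _)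
  have hI : ∫ x, ∑ i, ⟪fderiv ℝ v x (e i), fderiv ℝ W x (e i)⟫ = -(ν⁻¹ * (w2 + pc)) := by
    have iS1 : Integrable (fun x => ⟪W x, W x⟫ + ⟪cross (curl v x) (v x), W x⟫) volume :=
      iWW.add icW
    have iS2 : Integrable (fun x => ⟪W x, W x⟫ + ⟪cross (curl v x) (v x), W x⟫ +
        ⟪gradient B x, W x⟫) volume := iS1.add igB
    rw [hLap, integral_congr_ae (Eventually.of_forall hpt), integral_const_mul,
      integral_add iS2 igW, integral_add iS1 igB, integral_add iWW icW, hpress, hpressB, add_zero,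
      add_zero, hWW]
  -- THE LAMB–ENERGY SLACK: test against `W + λ v`, `λ = ν Z'/E`
  set lam : ℝ := ν * Z' / E with hlam
  have hX2 : ∫ x, ‖W x + lam • v x‖ ^ 2 = w2 - ν ^ 2 * Z' ^ 2 / E := by
    have hexp : ∀ x, ‖W x + lam • v x‖ ^ 2 = ‖W x‖ ^ 2 + 2 * lam * ⟪v x, W x⟫ + lam ^ 2 * ‖v x‖ ^ 2 := by
      intro x
      rw [norm_add_sq_real, norm_smul, real_inner_smul_right, real_inner_comm, mul_pow,
        Real.norm_eq_abs, sq_abs]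
      ring
    have hA : Integrable (fun x => ‖W x‖ ^ 2 + 2 * lam * ⟪v x, W x⟫) volume :=
      isqW.add (ivW.const_mul (2 * lam))
    have hBB : Integrable (fun x => lam ^ 2 * ‖v x‖ ^ 2) volume := isqv.const_mul (lam ^ 2)
    have hA2 : Integrable (fun x => 2 * lam * ⟪v x, W x⟫) volume := ivW.const_mul (2 * lam)
    have hint : ∫ x, ‖W x + lam • v x‖ ^ 2 = w2 + 2 * lam * (∫ x, ⟪v x, W x⟫) + lam ^ 2 * E := by
      rw [integral_congr_ae (Eventually.of_forall hexp), integral_add hA hBB, integral_add isqW hA2,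
        integral_const_mul, integral_const_mul]
    rw [hint, hEW]
    rcases eq_or_lt_of_le hE0 with hE00 | hEpos
    · have hl0 : lam = 0 := by rw [hlam, ← hE00, div_zero]
      rw [hl0, ← hE00]
      simp
    · rw [hlam]
      field_simp
      ring
  have hX0 : 0 ≤ w2 - ν ^ 2 * Z' ^ 2 / E := by
    rw [← hX2]; exact integral_nonneg fun x => sq_nonneg _
  have hCS : |pc| ≤ Real.sqrt a2 * Real.sqrt (w2 - ν ^ 2 * Z' ^ 2 / E) := by
    rw [← hX2]
    exact abs_integral_inner_le_of_inner_eq_zero (fun x => inner_cross_curl_self _ _) mL mW mv lam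
  -- `ab ≤ a²/4 + b²`
  have hkey : -(w2 + pc) ≤ a2 / 4 - ν ^ 2 * Z' ^ 2 / E := by
    have h1 : -pc ≤ Real.sqrt a2 * Real.sqrt (w2 - ν ^ 2 * Z' ^ 2 / E) :=
      (neg_le_abs pc).trans hCS
    have hsa : Real.sqrt a2 ^ 2 = a2 := Real.sq_sqrt ha20
    have hsX : Real.sqrt (w2 - ν ^ 2 * Z' ^ 2 / E) ^ 2 = w2 - ν ^ 2 * Z' ^ 2 / E := Real.sq_sqrt hX0
    nlinarith [sq_nonneg (Real.sqrt a2 / 2 - Real.sqrt (w2 - ν ^ 2 * Z' ^ 2 / E))]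
  -- assemble
  rw [hI]
  have hνi : 0 < ν⁻¹ := inv_pos.2 hν
  calc -(ν⁻¹ * (w2 + pc)) = ν⁻¹ * (-(w2 + pc)) := by ring
    _ ≤ ν⁻¹ * (a2 / 4 - ν ^ 2 * Z' ^ 2 / E) := mul_le_mul_of_nonneg_left hkey hνi.le
    _ = (4 * ν)⁻¹ * a2 - ν * Z' ^ 2 / E := by
        field_simp
    _ ≤ (4 * ν)⁻¹ * P2 - ν * Z' ^ 2 / E := by
        gcongr

end Summit.NavierStokesRegularity.NavierStokesRegularity.Theorems.DepletionLadder

end
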